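import Summits.Schanuel.Schanuel.Theses.BenfordTowers
import Literature.NumberTheory.DiophantineApproximation.KroneckerTheorem
import Summits.KontsevichZagierPeriods.KontsevichZagierPeriods.Theorems.SymplecticScissorsVolumeFormOffPlaneRankTwoLogRatio

/-!
BC5 special case of piece 1 `HomPrimeLogSector` (crux strategist, stmt-Schanuel-11400): TWO PRIMES,
EVERY DEGREE (`r = 2`), with NO sorry — unconditional via the tree's PROVED Gelfond–Schneider
(`gelfond_schneider_holds`) in the packaged form of the Kontsevich–Zagier summit's
`stub_rankTwoLogRatio` (no non-zero homogeneous form over `ℚ` vanishes at `(log α, log β)` for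
multiplicatively independent positive algebraic `α, β`; cross-summit import allowed by CONVENTIONS §2).
With piece 2 (`BenfordOfHom`) this yields: every admissible tower family over a single non-base
prime is Benford at every level, unconditionally.
-/

open Summit.Schanuel.Schanuel.Theses.BenfordTowers MvPolynomial
open Summit.KontsevichZagierPeriods.SymplecticScissors.LogPolytope
open scoped BigOperators

namespace Summit.Schanuel.Schanuel.Cruxes.HomPrimeLogSector.TwoPrimes

/-- Multiplicative independence of two distinct primes, via the `ℤ`-linear independence of
logarithms of primes (tree `Kronecker.linearIndependent_log_of_prime`). -/
theorem zpow_mul_zpow_eq_one {p q : ℕ} (hp : p.Prime) (hq : q.Prime) (hpq : p ≠ q) :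
    ∀ a b : ℤ, (p : ℝ) ^ a * (q : ℝ) ^ b = 1 → a = 0 ∧ b = 0 := by
  classical
  intro a b h
  have hp0 : (0 : ℝ) < p := by exact_mod_cast hp.pos
  have hq0 : (0 : ℝ) < q := by exact_mod_cast hq.pos
  have hlog : (a : ℝ) * Real.log p + (b : ℝ) * Real.log q = 0 := by
    have := congrArg Real.log h
    rw [Real.log_mul (zpow_ne_zero _ hp0.ne') (zpow_ne_zero _ hq0.ne'), Real.log_zpow,
      Real.log_zpow, Real.log_one] at this
    exact this
  let s : Finset ℕ := {p, q}
  have hs : ∀ x ∈ s, x.Prime := by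
    intro x hx
    simp only [s, Finset.mem_insert, Finset.mem_singleton] at hx
    rcases hx with rfl | rfl
    · exact hp
    · exact hq
  have hli := Literature.NumberTheory.DiophantineApproximation.Kronecker.linearIndependent_log_of_prime
    s hs
  let κ : s → ℤ := fun x => if (x : ℕ) = p then a else b
  have hrel : ∑ x : s, κ x • Real.log ((x : ℕ) : ℝ) = 0 := by
    have hcoe : ∑ x : s, κ x • Real.log ((x : ℕ) : ℝ)
        = ∑ x ∈ s, (if x = p then a else b) • Real.log (x : ℝ) :=
      Finset.sum_coe_sort s (fun x : ℕ => (if x = p then a else b) • Real.log (x : ℝ))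
    rw [hcoe, Finset.sum_pair hpq]
    simp only [if_true, if_neg (Ne.symm hpq), zsmul_eq_mul]
    exact hlog
  have hκ := Fintype.linearIndependent_iff.mp hli κ hrel
  have ha := hκ ⟨p, by simp [s]⟩
  have hb := hκ ⟨q, by simp [s]⟩
  simp only [κ, if_true] at ha
  simp only [κ, if_neg (Ne.symm hpq)] at hb
  exact ⟨ha, hb⟩

/-- **Two primes, every degree** (`r = 2` of `HomPrimeLogSector`), PROVED. -/
theorem homPrimeLogSector_two_primes :
    ∀ (ℓ : Fin 2 → ℕ), (∀ i, (ℓ i).Prime) → Function.Injective ℓ →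
      ∀ (d : ℕ) (P : MvPolynomial (Fin 2) ℚ), P.IsHomogeneous d → P ≠ 0 →
        MvPolynomial.aeval (fun i => Real.log (ℓ i)) P ≠ 0 := by
  intro ℓ hℓ hinj d P hhom hP hzero
  classical
  have hα : (0 : ℝ) < ℓ 0 := by exact_mod_cast (hℓ 0).pos
  have hβ : (0 : ℝ) < ℓ 1 := by exact_mod_cast (hℓ 1).pos
  have hαa : IsAlgebraic ℚ ((ℓ 0 : ℕ) : ℝ) := by
    simpa using isAlgebraic_algebraMap (R := ℚ) (A := ℝ) ((ℓ 0 : ℕ) : ℚ)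
  have hβa : IsAlgebraic ℚ ((ℓ 1 : ℕ) : ℝ) := by
    simpa using isAlgebraic_algebraMap (R := ℚ) (A := ℝ) ((ℓ 1 : ℕ) : ℚ)
  have h01 : ℓ 0 ≠ ℓ 1 := fun h => absurd (hinj h) (by decide)
  have hind := zpow_mul_zpow_eq_one (hℓ 0) (hℓ 1) h01
  -- the exponent vectors of a degree-`d` form in two variables
  let mk : Fin (d + 1) → (Fin 2 →₀ ℕ) := fun k =>
    Finsupp.single 0 (k : ℕ) + Finsupp.single 1 (d - (k : ℕ))
  have hmk0 : ∀ k, mk k 0 = (k : ℕ) := fun k => by simp [mk]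
  have hmk1 : ∀ k, mk k 1 = d - (k : ℕ) := fun k => by simp [mk]
  have hmk_inj : Function.Injective mk := by
    intro k k' h
    have := congrArg (fun m => m 0) h
    simp only [hmk0] at this
    exact Fin.ext this
  -- every monomial in the support is some `mk k`
  have hsupp : ∀ m ∈ P.support, ∃ k, mk k = m := by
    intro m hm
    have h := hhom (mem_support_iff.mp hm)
    rw [Finsupp.weight_apply, Finsupp.sum_fintype _ _ (fun _ => by simp)] at h
    simp only [Pi.one_apply, smul_eq_mul, mul_one, Fin.sum_univ_two] at h
    refine ⟨⟨m 0, by omega⟩, ?_⟩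
    ext i
    fin_cases i
    · simp [mk]
    · simp [mk]; omega
  -- the coefficient vector
  let c : Fin (d + 1) → ℚ := fun k => coeff (mk k) P
  have hPeq : P = ∑ k, monomial (mk k) (c k) := by
    ext m
    rw [coeff_sum]
    simp only [coeff_monomial]
    by_cases hm : ∃ k, mk k = m
    · obtain ⟨k, rfl⟩ := hm
      rw [Finset.sum_eq_single k]
      · simp [c]
      · intro j _ hjk
        rw [if_neg (fun h => hjk (hmk_inj h))]
      · simp
    · have h0 : coeff m P = 0 := by
        by_contra hne
        exact hm (hsupp m (mem_support_iff.mpr hne))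
      rw [h0]
      symm
      exact Finset.sum_eq_zero fun j _ => if_neg (fun h => hm ⟨j, h⟩)
  -- evaluate
  have hsum : ∑ k : Fin (d + 1), (c k : ℝ) * Real.log (ℓ 0) ^ (k : ℕ) * Real.log (ℓ 1) ^ (d - (k : ℕ))
      = 0 := by
    have h := hzero
    rw [hPeq, map_sum] at h
    rw [← h]
    refine Finset.sum_congr rfl fun k _ => ?_
    rw [aeval_monomial, Finsupp.prod_fintype _ _ (fun _ => pow_zero _), Fin.prod_univ_two,
      hmk0, hmk1, eq_ratCast]
    ring
  have hc := stub_rankTwoLogRatio (ℓ 0) (ℓ 1) hα hβ hαa hβa hind d c hsum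
  apply hP
  rw [hPeq]
  simp [hc]

end Summit.Schanuel.Schanuel.Cruxes.HomPrimeLogSector.TwoPrimes
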